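import Mathlib

/-!
# Route BarrierLever — item `PartitionMinorsHitByVP` (stmt-ValiantsHypothesis-19717):
# generalized Vandermonde matrices `(∏_{c ∈ w_j} P_i(c))_{i,j}` — RECURSIVE EVEN SPLITS ⇒ nonsingular

Helper file (`--supports stmt-ValiantsHypothesis-19717`; cell valiant-natproofs, rung V4, 𝒟-side of
door (c); prover seat val-np-p3 gen 4). Definition-free, cone-free (imports `Mathlib` only). Closes
NO item. Part 1 of the SUBSET-SUM VANDERMONDE witness (memo
`HOME/val-np-p3/g4/evidence-subsetsum-witness-valnp3-g4.md`): the layout matrix of that witness is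
`M[i,j] = ∏_{c ∈ w_j} P_i(c)` — the monomials `z^{w_j}` evaluated at points `P_i` — and this file gives
the purely combinatorial criterion for its nonsingularity when the columns are ALL subsets of a
block `T`.

Write `ev_T(c, q) = Σ_{W ⊆ T} c(W) · ∏_{x ∈ W} q(x)` for the multiaffine polynomial with coefficient
function `c` evaluated at the point `q` (spelled out in every statement; no definition). A row set
`R` is UNISOLVENT on `T` if `ev_T(c, P_i) = 0` for all `i ∈ R` forces `c = 0` on `𝒫(T)`.

* `unisolvent_of_subsingleton_coords` — base case `T = ∅`, `R` nonempty.
* **`unisolvent_split`** (the FACTORIZATION STEP). If `c₀ ∈ T` and the level set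
  `R₀ = {i ∈ R : P_i(c₀) = α}` and its complement `R₁ = {i ∈ R : P_i(c₀) ≠ α}` are both unisolvent
  on `T ∖ {c₀}`, then `R` is unisolvent on `T`. (Write `F = F₀ + (z_{c₀} - α)·F₁`; on `R₀` only
  `F₀` is seen, so `F₀ = 0`; then on `R₁` the nonzero factor `P_i(c₀) - α` can be cancelled, so
  `F₁ = 0`.) Iterating: a row set of size `2^|T|` that splits RECURSIVELY into halves by level sets
  of coordinates is unisolvent — the «recursive even split» criterion of the memo. Different branches
  may use different levels `α`.
* **`det_ne_zero_of_unisolvent`** — if the columns `w_j` enumerate the subsets of `T` bijectively and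
  the rows are unisolvent on `T`, the square matrix `(∏_{c ∈ w_j} P_i(c))_{i,j}` has `det ≠ 0`.
* `unisolvent_cube` — the standard instance: if the points restricted to `T` are `0/1`-valued and
  `i ↦ {c ∈ T : P_i(c) = 1}` is a bijection onto `𝒫(T)`, the rows are unisolvent (the matrix is
  the inclusion matrix of `𝒫(T)`; a minimal-support argument).

WHAT THIS IS NOT: no statement about which set families admit recursive splits (the EVEN-SPLIT
LEMMA of the memo is open beyond `2^|T| ≤ 8`); nothing on item 19717 itself, crux 14610 or `VP ≠ VNP`.
-/

set_option linter.dupNamespace false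

open Finset

namespace Summit.ValiantsHypothesis.ValiantsHypothesis.Theorems.BarrierLever.SubsetSum

variable {σ ι : Type*} [DecidableEq σ]

/-! ## 1. Splitting one coordinate off the multiaffine evaluation -/

/-- `ev_T(c,q) = ev_{T∖c₀}(W ↦ c(W) + q(c₀)·c(W ∪ {c₀}), q)` for `c₀ ∈ T`. -/
theorem ev_split (T : Finset σ) {c₀ : σ} (hc₀ : c₀ ∈ T) (c : Finset σ → ℂ) (q : σ → ℂ) :
    (∑ W ∈ T.powerset, c W * ∏ x ∈ W, q x) =
      ∑ W ∈ (T.erase c₀).powerset, (c W + q c₀ * c (insert c₀ W)) * ∏ x ∈ W, q x := by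
  have hT : T = insert c₀ (T.erase c₀) := (Finset.insert_erase hc₀).symm
  conv_lhs => rw [hT]
  rw [Finset.sum_powerset_insert (Finset.notMem_erase c₀ T)]
  rw [← Finset.sum_add_distrib]
  refine Finset.sum_congr rfl fun W hW => ?_
  have hc₀W : c₀ ∉ W := fun h => Finset.notMem_erase c₀ T (Finset.mem_powerset.1 hW h)
  rw [Finset.prod_insert hc₀W]
  ring

/-! ## 2. Unisolvence: base case and the splitting step -/

omit [DecidableEq σ] in
/-- Base case: on `T = ∅` any nonempty row set is unisolvent (`ev_∅(c, q) = c(∅)`). -/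
theorem unisolvent_empty (P : ι → σ → ℂ) (R : Finset ι) (hR : R.Nonempty) :
    ∀ c : Finset σ → ℂ, (∀ i ∈ R, (∑ W ∈ (∅ : Finset σ).powerset, c W * ∏ x ∈ W, P i x) = 0) →
      ∀ W ∈ (∅ : Finset σ).powerset, c W = 0 := by
  intro c hc W hW
  obtain ⟨i, hi⟩ := hR
  have h0 := hc i hi
  rw [Finset.powerset_empty, Finset.sum_singleton, Finset.prod_empty, mul_one] at h0
  rw [Finset.powerset_empty, Finset.mem_singleton] at hW
  rw [hW, h0]

/-- **The splitting step** (factorization lemma). Let `c₀ ∈ T`, `α ∈ ℂ`, and split the rows `R` into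
the level set `R₀ = {P_i(c₀) = α}` and the rest `R₁`. If both `R₀` and `R₁` are unisolvent on
`T ∖ {c₀}`, then `R` is unisolvent on `T`. -/
theorem unisolvent_split (P : ι → σ → ℂ) (T : Finset σ) {c₀ : σ} (hc₀ : c₀ ∈ T) (α : ℂ)
    (R : Finset ι)
    (h₀ : ∀ c : Finset σ → ℂ,
      (∀ i ∈ R.filter (fun i => P i c₀ = α),
        (∑ W ∈ (T.erase c₀).powerset, c W * ∏ x ∈ W, P i x) = 0) →
      ∀ W ∈ (T.erase c₀).powerset, c W = 0)
    (h₁ : ∀ c : Finset σ → ℂ,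
      (∀ i ∈ R.filter (fun i => P i c₀ ≠ α),
        (∑ W ∈ (T.erase c₀).powerset, c W * ∏ x ∈ W, P i x) = 0) →
      ∀ W ∈ (T.erase c₀).powerset, c W = 0) :
    ∀ c : Finset σ → ℂ, (∀ i ∈ R, (∑ W ∈ T.powerset, c W * ∏ x ∈ W, P i x) = 0) →
      ∀ W ∈ T.powerset, c W = 0 := by
  intro c hc
  -- the two half-coefficient functions
  set e : Finset σ → ℂ := fun W => c W + α * c (insert c₀ W) with he
  set c₁ : Finset σ → ℂ := fun W => c (insert c₀ W) with hc₁
  -- Step 1: on the level set only `e` is seen, so `e = 0` on `𝒫(T ∖ c₀)`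
  have he0 : ∀ W ∈ (T.erase c₀).powerset, e W = 0 := by
    refine h₀ e fun i hi => ?_
    obtain ⟨hiR, hiα⟩ := Finset.mem_filter.1 hi
    have := hc i hiR
    rw [ev_split T hc₀ c (P i), hiα] at this
    exact this
  -- Step 2: off the level set, `ev(c₁, P_i) = 0` after cancelling `P_i(c₀) - α ≠ 0`
  have hc₁0 : ∀ W ∈ (T.erase c₀).powerset, c₁ W = 0 := by
    refine h₁ c₁ fun i hi => ?_
    obtain ⟨hiR, hiα⟩ := Finset.mem_filter.1 hi
    have hev := hc i hiR
    rw [ev_split T hc₀ c (P i)] at hev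
    have hdecomp : (∑ W ∈ (T.erase c₀).powerset, (c W + P i c₀ * c (insert c₀ W)) * ∏ x ∈ W, P i x) =
        (∑ W ∈ (T.erase c₀).powerset, e W * ∏ x ∈ W, P i x) +
          (P i c₀ - α) * ∑ W ∈ (T.erase c₀).powerset, c₁ W * ∏ x ∈ W, P i x := by
      rw [Finset.mul_sum, ← Finset.sum_add_distrib]
      refine Finset.sum_congr rfl fun W _ => ?_
      simp only [he, hc₁]
      ring
    have hfirst : (∑ W ∈ (T.erase c₀).powerset, e W * ∏ x ∈ W, P i x) = 0 :=
      Finset.sum_eq_zero fun W hW => by rw [he0 W hW, zero_mul]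
    rw [hdecomp, hfirst, zero_add] at hev
    rcases mul_eq_zero.1 hev with h | h
    · exact absurd (sub_eq_zero.1 h) hiα
    · exact h
  -- Step 3: assemble
  intro W hW
  by_cases hW0 : c₀ ∈ W
  · have hW' : W.erase c₀ ∈ (T.erase c₀).powerset :=
      Finset.mem_powerset.2 (Finset.erase_subset_erase c₀ (Finset.mem_powerset.1 hW))
    have := hc₁0 (W.erase c₀) hW'
    simp only [hc₁, Finset.insert_erase hW0] at this
    exact this
  · have hW' : W ∈ (T.erase c₀).powerset := by
      rw [Finset.mem_powerset]
      intro x hx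
      exact Finset.mem_erase.2 ⟨fun hx0 => hW0 (hx0 ▸ hx), Finset.mem_powerset.1 hW hx⟩
    have h1 := he0 W hW'
    have h2 := hc₁0 W hW'
    simp only [he, hc₁] at h1 h2
    rw [h2, mul_zero, add_zero] at h1
    exact h1

/-! ## 3. From unisolvence to the determinant -/

/-- **Nonsingularity.** If the columns `w j` enumerate the subsets of `T` bijectively and the rows
are unisolvent on `T`, the generalized Vandermonde matrix `(∏_{c ∈ w j} P_i(c))_{i,j}` is
nonsingular. -/
theorem det_ne_zero_of_unisolvent {r : ℕ} (P : Fin r → σ → ℂ) (T : Finset σ)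
    (w : Fin r → Finset σ) (hwT : ∀ j, w j ⊆ T) (hwinj : Function.Injective w)
    (hwsurj : ∀ W, W ⊆ T → ∃ j, w j = W)
    (huni : ∀ c : Finset σ → ℂ,
      (∀ i ∈ (Finset.univ : Finset (Fin r)), (∑ W ∈ T.powerset, c W * ∏ x ∈ W, P i x) = 0) →
      ∀ W ∈ T.powerset, c W = 0) :
    (Matrix.of fun i j : Fin r => ∏ x ∈ w j, P i x).det ≠ 0 := by
  classical
  intro hdet
  obtain ⟨v, hv0, hMv⟩ := Matrix.exists_mulVec_eq_zero_iff.2 hdet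
  -- the coefficient function carried by `v`
  let c : Finset σ → ℂ := fun W => if hW : ∃ j, w j = W then v hW.choose else 0
  have hcw : ∀ j, c (w j) = v j := by
    intro j
    have hex : ∃ j', w j' = w j := ⟨j, rfl⟩
    simp only [c, dif_pos hex]
    congr 1
    exact hwinj hex.choose_spec
  have himage : T.powerset = (Finset.univ : Finset (Fin r)).image w := by
    ext W
    rw [Finset.mem_powerset, Finset.mem_image]
    constructor
    · intro hW
      obtain ⟨j, hj⟩ := hwsurj W hW
      exact ⟨j, Finset.mem_univ _, hj⟩
    · rintro ⟨j, -, rfl⟩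
      exact hwT j
  have hev : ∀ i ∈ (Finset.univ : Finset (Fin r)), (∑ W ∈ T.powerset, c W * ∏ x ∈ W, P i x) = 0 := by
    intro i _
    rw [himage, Finset.sum_image (fun j _ j' _ hjj' => hwinj hjj')]
    have hi := congrFun hMv i
    rw [Matrix.mulVec, Pi.zero_apply] at hi
    change (∑ j, (Matrix.of fun i j : Fin r => ∏ x ∈ w j, P i x) i j * v j) = 0 at hi
    rw [← hi]
    refine Finset.sum_congr rfl fun j _ => ?_
    rw [hcw j, Matrix.of_apply, mul_comm]
  have hc0 := huni c hev
  apply hv0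
  funext j
  rw [← hcw j]
  exact hc0 (w j) (Finset.mem_powerset.2 (hwT j))

/-! ## 4. The cube instance: `0/1` points in bijection with `𝒫(T)` -/

/-- **Cube points are unisolvent.** If on `T` the points take only the values `0, 1` and
`i ↦ {c ∈ T : P_i(c) = 1}` hits every subset of `T`, the rows are unisolvent on `T`: the evaluation
`ev_T(c, P_i) = Σ_{W ⊆ supp P_i} c(W)` is the zeta transform, inverted at a minimal nonzero `W`. -/
theorem unisolvent_cube (P : ι → σ → ℂ) (T : Finset σ) (R : Finset ι)
    (h01 : ∀ i ∈ R, ∀ x ∈ T, P i x = 0 ∨ P i x = 1)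
    (hsurj : ∀ W, W ⊆ T → ∃ i ∈ R, ∀ x ∈ T, P i x = 1 ↔ x ∈ W) :
    ∀ c : Finset σ → ℂ, (∀ i ∈ R, (∑ W ∈ T.powerset, c W * ∏ x ∈ W, P i x) = 0) →
      ∀ W ∈ T.powerset, c W = 0 := by
  classical
  intro c hc
  -- the evaluation at the point with support `S` is the zeta transform `Σ_{W ⊆ S} c W`
  have hzeta : ∀ S, S ⊆ T → (∑ W ∈ S.powerset, c W) = 0 := by
    intro S hS
    obtain ⟨i, hiR, hi⟩ := hsurj S hS
    have hev := hc i hiR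
    have hsplit : (∑ W ∈ T.powerset, c W * ∏ x ∈ W, P i x) = ∑ W ∈ S.powerset, c W := by
      rw [← Finset.sum_subset (Finset.powerset_mono.2 hS)]
      · refine Finset.sum_congr rfl fun W hW => ?_
        have hW : W ⊆ S := Finset.mem_powerset.1 hW
        rw [Finset.prod_eq_one (fun x hx => (hi x (hS (hW hx))).2 (hW hx)), mul_one]
      · intro W hWT hWS
        rw [Finset.mem_powerset] at hWT hWS
        obtain ⟨x, hxW, hxS⟩ := Finset.not_subset.1 hWS
        have hx0 : P i x = 0 := by
          rcases h01 i hiR x (hWT hxW) with h0 | h1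
          · exact h0
          · exact absurd ((hi x (hWT hxW)).1 h1) hxS
        rw [Finset.prod_eq_zero hxW hx0, mul_zero]
    rw [hsplit] at hev
    exact hev
  -- Möbius inversion: were some `c W ≠ 0`, take such a `W` of minimal size; then `Σ_{W' ⊆ W} c W' = c W`
  by_contra hne
  obtain ⟨W₀, hW₀⟩ := not_forall.1 hne
  obtain ⟨hW₀T, hW₀⟩ := Classical.not_imp.1 hW₀
  obtain ⟨W, hW, hWmin⟩ := Finset.exists_min_image (T.powerset.filter (fun W => c W ≠ 0))
    (fun W => W.card) ⟨W₀, Finset.mem_filter.2 ⟨hW₀T, hW₀⟩⟩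
  obtain ⟨hWT, hcW⟩ := Finset.mem_filter.1 hW
  have hWT' : W ⊆ T := Finset.mem_powerset.1 hWT
  have hz := hzeta W hWT'
  rw [← Finset.sum_erase_add _ _ (Finset.mem_powerset.2 (subset_refl W))] at hz
  have hrest : (∑ W' ∈ W.powerset.erase W, c W') = 0 := by
    refine Finset.sum_eq_zero fun W' hW' => ?_
    obtain ⟨hne', hW'W⟩ := Finset.mem_erase.1 hW'
    have hW'W : W' ⊆ W := Finset.mem_powerset.1 hW'W
    by_contra hcW'
    have hlt : W'.card < W.card := Finset.card_lt_card (lt_of_le_of_ne hW'W hne')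
    have hle := hWmin W' (Finset.mem_filter.2 ⟨Finset.mem_powerset.2 (hW'W.trans hWT'), hcW'⟩)
    omega
  rw [hrest, zero_add] at hz
  exact hcW hz

end Summit.ValiantsHypothesis.ValiantsHypothesis.Theorems.BarrierLever.SubsetSum
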